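import Summits.HodgeConjecture.CorCM.MultiFieldWeilUnitsDefectLaw
import HarnessLib

/-!
# MULTI-FIELD WEIL ENGINE — CROSS-DEGREE DECOUPLING (census level): the mass-zero permutation module of a closed `2`-transitive set of permutations is
# IRREDUCIBLE, and the matrix coefficients of a `2`-transitive slot are ORTHOGONAL to those of every slot with FEWER letters — no hypothesis relating the slots

Cell `pub-hodgecm2` (COR-CM), seat b30 gen 41 (2026-08-26); count-neutral own lane MULTI-FIELD WEIL ENGINE (stem `MultiFieldWeil*`), census level (abstract sets of
tuples of permutations), the representation-theoretic complement of the STABILISER-TRANSITIVE TRANSFER (`CorCM/MultiFieldWeilStabiliserTransfer.lean`,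
`CorCM/MultiFieldWeilTwinUnits.lean` §1 `signed_transfer_units`): there, the signed equations of a tuple set `R ⊆ ∏_m Sym(n_m)` are transferred to the unit-wise product
of its images by MOVERS (a tuple trivial on one unit moving a slot of another) — a hypothesis that the realised reading must buy from the arithmetic of the CM fields
(`Hom = ∅`, «a value outside the Galois closure», «closure degree»).  Here the transfer between slots of DIFFERENT sizes costs NOTHING.  Theorems only; no definition,
no named fact, no `sorry`, no `decide`.  HONEST FRAMING: pure finite linear algebra over `ℚ`; `HC_CM` is NOT touched.

THE TWO FACTS.
* §1 **IRREDUCIBILITY** (`massZero_mem_of_invariant_ne_bot`).  `H ⊆ Sym(k)` non-empty, closed under products and inverses, `2`-TRANSITIVE: a non-zero `ℚ`-subspace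
  `W` of mass-zero functions on the `k` letters that is stable under `w ↦ w ∘ σ` (`σ ∈ H`) contains EVERY mass-zero function (symmetrise a `w ∈ W` with `w(a) ≠ 0` over
  the stabiliser of `a`: the result is `w(a)·|H_a|` at `a` and constant elsewhere, i.e. a non-zero multiple of the cell vector `k·𝟙_a − 𝟙`; translate by `H`).
* §2 **ORTHOGONALITY OF MATRIX COEFFICIENTS** (`sum_coeff_mul_coeff_eq_zero`, `…'`).  `R ⊆ ∏_m Sym(n_m)` non-empty, closed under products and inverses; slots `m, m'`
  with `n_m < n_{m'}`, `R` `2`-transitive at `m'`; `f` mass-zero on the letters of `m`: `Σ_{π ∈ R} ⟨f ∘ π_m, g⟩ · ⟨f' ∘ π_{m'}, g'⟩ = 0`.  PROOF: the averaging operator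
  `T(x) = Σ_{π ∈ R} ⟨x ∘ π_m, g⟩ · (g'° ∘ π_{m'}⁻¹)` (`g'°` = `g'` centred) is `R`-equivariant from the mass-zero functions of slot `m` to those of slot `m'`; its image
  is an `R`-stable subspace of rank `≤ n_m − 1 < n_{m'} − 1`, zero by §1; and `⟨T f, f'⟩` is the sum in question (Schur orthogonality, certified by DIMENSION alone).
* §3 **THE CENTRED SIGNED SLOT SUMS ARE MATRIX COEFFICIENTS** (`centred_signed_sum_eq`, `sum_centredSigned_mul_eq_zero`): `E_m(σ) − A_m = 2·⟨(𝟙_{P_m} − |P_m|/n_m) ∘ σ, d_m⟩`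
  (`E_m(σ) = Σ_a ±_{σ a ∈ P_m} d_m(a)`, `A_m = (2|P_m| − n_m)·(Σ d_m)/n_m`), hence `Σ_{π ∈ R} (E_m(π_m) − A_m)(E_{m'}(π_{m'}) − A_{m'}) = 0` for `n_m < n_{m'}`, `R`
  `2`-transitive at `m'` — the input of the RANKED TRANSFER (sequel `CorCM/MultiFieldWeilRankedTransfer.lean`): below a `2`-transitive unit every unit with fewer letters
  DECOUPLES in the signed equations with NO hypothesis relating the two CM fields (octic over sextic: «a value outside the closure» disappears).
[cite: Serre1977, §2.2 Cor. 2–3 of Prop. 4; §2.3 Ex. 2.6] [cite: DixonMortimer1996, §1.4 Ex. 1.4.1–1.4.2; §2.1] [cite: Lang2002, XIII §4; XVIII §5]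
[cite: MoonenZarhin1995Duke, Thm. 2.4]

## References
* [Serre1977] J.-P. Serre, *Linear Representations of Finite Groups*, GTM 42, §2.2 (Schur's lemma; Cor. 2–3: orthogonality of matrix coefficients), §2.3 Ex. 2.6
  (`2`-transitive ⟹ `1 ⊕` irreducible).  [DixonMortimer1996] J. D. Dixon, B. Mortimer, *Permutation Groups*, GTM 163, §1.4, §2.1.  [Lang2002] S. Lang, *Algebra*,
  GTM 211, XIII §4, XVIII §5.  [MoonenZarhin1995Duke] B. Moonen, Yu. Zarhin, Duke Math. J. 77 (1995), Thm. 2.4.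
-/

noncomputable section

namespace Summit.HodgeConjecture.CorCM.MultiFieldWeil

open Finset
open Summit.HodgeConjecture.CorCM.Census.MultiFieldWeil

open scoped Classical

/-! ## §1 Irreducibility of the mass-zero module of a closed `2`-transitive set of permutations -/

section Irreducible
variable {k : ℕ} {H : Finset (Equiv.Perm (Fin k))}

/-- A non-empty set of permutations closed under products and inverses contains `1`. [folklore] -/
theorem one_mem_perm_of_closed (hmul : ∀ σ ∈ H, ∀ σ' ∈ H, σ * σ' ∈ H) (hinv : ∀ σ ∈ H, σ⁻¹ ∈ H) (hne : H.Nonempty) :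
    (1 : Equiv.Perm (Fin k)) ∈ H := by
  obtain ⟨σ, hσ⟩ := hne
  have h := hmul σ hσ σ⁻¹ (hinv σ hσ)
  rwa [mul_inv_cancel] at h

/-- The cell vectors `k·𝟙_c − 𝟙` reproduce every mass-zero function: `Σ_c v(c)·(k·𝟙_c − 𝟙) = k·v` when `Σ v = 0`. [cite: Lang2002, XIII §4] -/
theorem sum_smul_cellVec_eq (v : Fin k → ℚ) (hv : ∑ x, v x = 0) :
    (∑ c : Fin k, v c • (fun x : Fin k => if x = c then (k : ℚ) - 1 else -1)) = (k : ℚ) • v := by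
  funext x
  rw [Finset.sum_apply, Pi.smul_apply, smul_eq_mul]
  simp only [Pi.smul_apply, smul_eq_mul]
  rw [← Finset.add_sum_erase _ _ (Finset.mem_univ x), if_pos rfl,
    Finset.sum_congr rfl fun c hc => by rw [if_neg (Finset.ne_of_mem_erase hc).symm]]
  have h1 : ∑ c ∈ Finset.univ.erase x, v c * (-1 : ℚ) = -(∑ c ∈ Finset.univ.erase x, v c) := by
    rw [← Finset.sum_neg_distrib]
    exact Finset.sum_congr rfl fun c _ => by ring
  rw [h1, Finset.sum_erase_eq_sub (Finset.mem_univ x), hv]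
  ring

/-- **IRREDUCIBILITY OF THE MASS-ZERO MODULE UNDER A CLOSED `2`-TRANSITIVE SET OF PERMUTATIONS.**  `H ⊆ Sym(k)` non-empty, closed under products and inverses,
`2`-transitive; `W` a `ℚ`-subspace of mass-zero functions stable under `w ↦ w ∘ σ` (`σ ∈ H`), `W ≠ 0`: then `W` contains every mass-zero function.
[cite: Serre1977, §2.3 Ex. 2.6] [cite: DixonMortimer1996, §1.4 Ex. 1.4.1–1.4.2; §2.1] -/
theorem massZero_mem_of_invariant_ne_bot (hmul : ∀ σ ∈ H, ∀ σ' ∈ H, σ * σ' ∈ H) (hinv : ∀ σ ∈ H, σ⁻¹ ∈ H) (hne : H.Nonempty)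
    (h2t : ∀ a a' b b' : Fin k, a ≠ a' → b ≠ b' → ∃ σ ∈ H, σ a = b ∧ σ a' = b')
    {W : Submodule ℚ (Fin k → ℚ)} (hW0 : ∀ w ∈ W, ∑ x, w x = 0) (hWH : ∀ σ ∈ H, ∀ w ∈ W, (fun x => w (σ x)) ∈ W) (hW : W ≠ ⊥)
    {v : Fin k → ℚ} (hv : ∑ x, v x = 0) : v ∈ W := by
  obtain ⟨w, hwW, hw0⟩ := (Submodule.ne_bot_iff W).1 hW
  obtain ⟨a, ha⟩ : ∃ a, w a ≠ 0 := by
    by_contra hno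
    push Not at hno
    exact hw0 (funext fun x => hno x)
  have h1 : (1 : Equiv.Perm (Fin k)) ∈ H := one_mem_perm_of_closed hmul hinv hne
  -- the symmetrisation of `w` over the stabiliser of `a`
  set S : Finset (Equiv.Perm (Fin k)) := H.filter fun σ => σ a = a with hS
  have h1S : (1 : Equiv.Perm (Fin k)) ∈ S := Finset.mem_filter.2 ⟨h1, rfl⟩
  set z : Fin k → ℚ := fun x => ∑ σ ∈ S, w (σ x) with hz
  have hzW : z ∈ W := by
    have hzeq : z = ∑ σ ∈ S, (fun x => w (σ x)) := by
      funext x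
      rw [Finset.sum_apply]
    rw [hzeq]
    exact Submodule.sum_mem W fun σ hσ => hWH σ (Finset.mem_filter.1 hσ).1 w hwW
  have hza : z a = (S.card : ℚ) * w a := by
    show (∑ σ ∈ S, w (σ a)) = (S.card : ℚ) * w a
    rw [Finset.sum_congr rfl fun σ hσ => by rw [(Finset.mem_filter.1 hσ).2], Finset.sum_const, nsmul_eq_mul]
  have hza0 : z a ≠ 0 := by
    rw [hza]
    exact mul_ne_zero (by exact_mod_cast (Finset.card_pos.2 ⟨1, h1S⟩).ne') ha
  -- `z` is constant off `a` (the stabiliser of `a` is transitive on the other letters)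
  have hzc : ∀ x y : Fin k, x ≠ a → y ≠ a → z x = z y := by
    intro x y hxa hya
    by_cases hxy : x = y
    · rw [hxy]
    obtain ⟨ρ, hρ, hρa, hρx⟩ := h2t a x a y (Ne.symm hxa) (Ne.symm hya)
    show (∑ σ ∈ S, w (σ x)) = ∑ σ ∈ S, w (σ y)
    refine Finset.sum_nbij' (fun σ => σ * ρ⁻¹) (fun σ => σ * ρ) (fun σ hσ => ?_) (fun σ hσ => ?_) (fun σ _ => inv_mul_cancel_right σ ρ)
      (fun σ _ => mul_inv_cancel_right σ ρ) (fun σ _ => ?_)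
    · have hσ' := Finset.mem_filter.1 hσ
      refine Finset.mem_filter.2 ⟨hmul σ hσ'.1 _ (hinv ρ hρ), ?_⟩
      rw [Equiv.Perm.mul_apply, show ρ⁻¹ a = a from (Equiv.Perm.inv_eq_iff_eq).2 hρa.symm, hσ'.2]
    · have hσ' := Finset.mem_filter.1 hσ
      exact Finset.mem_filter.2 ⟨hmul σ hσ'.1 ρ hρ, by rw [Equiv.Perm.mul_apply, hρa, hσ'.2]⟩
    · rw [Equiv.Perm.mul_apply, show ρ⁻¹ y = x from (Equiv.Perm.inv_eq_iff_eq).2 hρx.symm]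
  -- a second letter exists (else `Σ z = z a ≠ 0`)
  have hzsum : ∑ x, z x = 0 := hW0 z hzW
  obtain ⟨b, hba⟩ : ∃ b : Fin k, b ≠ a := by
    by_contra hno
    push Not at hno
    have hs : ∑ x, z x = z a := Finset.sum_eq_single a (fun x _ hx => absurd (hno x) hx) (fun h => absurd (Finset.mem_univ a) h)
    exact hza0 (hs ▸ hzsum)
  have hzx : ∀ x, x ≠ a → z x = z b := fun x hx => hzc x b hx hba
  have hrel : z a + ((k : ℚ) - 1) * z b = 0 := by
    rw [← Finset.add_sum_erase _ _ (Finset.mem_univ a), Finset.sum_congr rfl fun x hx => hzx x (Finset.ne_of_mem_erase hx), Finset.sum_const,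
      Finset.card_erase_of_mem (Finset.mem_univ a), Finset.card_univ, Fintype.card_fin, nsmul_eq_mul, Nat.cast_sub (Fin.pos a), Nat.cast_one] at hzsum
    exact hzsum
  -- the cell vector at `a` lies in `W`: `z a • (k 𝟙_a − 𝟙) = (k − 1) • z`
  have hsm : z a • (fun x : Fin k => if x = a then (k : ℚ) - 1 else -1) = ((k : ℚ) - 1) • z := by
    funext x
    simp only [Pi.smul_apply, smul_eq_mul]
    by_cases hx : x = a
    · rw [if_pos hx, hx]; ring
    · rw [if_neg hx, hzx x hx]; linarith [hrel]
  have hcella : (fun x : Fin k => if x = a then (k : ℚ) - 1 else -1) ∈ W := by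
    have heq : (fun x : Fin k => if x = a then (k : ℚ) - 1 else -1) = (z a)⁻¹ • (((k : ℚ) - 1) • z) := by
      rw [← hsm, smul_smul, inv_mul_cancel₀ hza0, one_smul]
    rw [heq]
    exact W.smul_mem _ (W.smul_mem _ hzW)
  -- every cell vector lies in `W` (translate by `H`)
  have hcell : ∀ c : Fin k, (fun x : Fin k => if x = c then (k : ℚ) - 1 else -1) ∈ W := by
    intro c
    by_cases hca : c = a
    · rw [hca]; exact hcella
    obtain ⟨σ, hσ, hσc, -⟩ := h2t c a a c hca (Ne.symm hca)
    have hmem := hWH σ hσ _ hcella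
    have heq : (fun x => (fun x : Fin k => if x = a then (k : ℚ) - 1 else -1) (σ x)) = fun x : Fin k => if x = c then (k : ℚ) - 1 else -1 := by
      funext x
      have hiff : σ x = a ↔ x = c := by rw [← hσc]; exact σ.injective.eq_iff
      simp only [hiff]
    rw [heq] at hmem
    exact hmem
  -- reproduce `v`
  have hk0 : (k : ℚ) ≠ 0 := by exact_mod_cast (Fin.pos a).ne'
  have hv' : v = (k : ℚ)⁻¹ • ∑ c : Fin k, v c • (fun x : Fin k => if x = c then (k : ℚ) - 1 else -1) := by
    rw [sum_smul_cellVec_eq v hv, smul_smul, inv_mul_cancel₀ hk0, one_smul]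
  rw [hv']
  exact W.smul_mem _ (Submodule.sum_mem W fun c _ => W.smul_mem _ (hcell c))
end Irreducible

/-! ## §2 Orthogonality of matrix coefficients: a `2`-transitive slot against a slot with fewer letters -/

section Orthogonal
variable {r : ℕ} {n : Fin r → ℕ} {R : Finset (PermsG n)}

/-- The kernel of the mass functional `x ↦ Σ x` on `j` letters has rank `≤ j − 1`. [cite: Lang2002, XIII §4] -/
theorem finrank_ker_le_of_eq_sum {j : ℕ} (L : (Fin j → ℚ) →ₗ[ℚ] ℚ) (hL : ∀ x, L x = ∑ i, x i) : Module.finrank ℚ (LinearMap.ker L) ≤ j - 1 := by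
  rcases Nat.eq_zero_or_pos j with hj | hj
  · have h := Submodule.finrank_le (LinearMap.ker L)
    rw [Module.finrank_fin_fun] at h
    omega
  · have htop : LinearMap.ker L ≠ ⊤ := fun h => by
      have h1 : (fun _ : Fin j => (1 : ℚ)) ∈ LinearMap.ker L := by rw [h]; exact Submodule.mem_top
      rw [LinearMap.mem_ker, hL, Finset.sum_const, Finset.card_univ, Fintype.card_fin, nsmul_eq_mul, mul_one] at h1
      exact (Nat.cast_eq_zero.1 h1 ▸ hj : (0 : ℕ) < 0).false
    have h := Submodule.finrank_lt htop
    rw [Module.finrank_fin_fun] at h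
    omega

/-- The kernel of a linear functional on `j` letters has rank `≥ j − 1`. [cite: Lang2002, XIII §4] -/
theorem le_finrank_ker_functional {j : ℕ} (L : (Fin j → ℚ) →ₗ[ℚ] ℚ) : j ≤ Module.finrank ℚ (LinearMap.ker L) + 1 := by
  have h := LinearMap.finrank_range_add_finrank_ker L
  have h1 := Submodule.finrank_le (LinearMap.range L)
  rw [Module.finrank_fin_fun] at h; rw [Module.finrank_self] at h1; omega

/-- **ORTHOGONALITY OF MATRIX COEFFICIENTS — a `2`-transitive slot against a slot with fewer letters.**  `R ⊆ ∏_m Sym(n_m)` non-empty, closed under products and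
inverses, `2`-transitive at the slot `m'`, `n_m < n_{m'}`; `f` mass-zero on the letters of `m`, `g'` mass-zero on the letters of `m'`, `g`, `f'` arbitrary: then
`Σ_{π ∈ R} ⟨f ∘ π_m, g⟩ · ⟨f' ∘ π_{m'}, g'⟩ = 0`.  (The image of the equivariant averaging operator `x ↦ Σ_π ⟨x ∘ π_m, g⟩ · g' ∘ π_{m'}⁻¹` on the mass-zero
functions is an `R`-stable subspace of rank `≤ n_m − 1 < n_{m'} − 1`, hence zero by §1.) [cite: Serre1977, §2.2 Cor. 2–3 of Prop. 4; §2.3 Ex. 2.6]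
[cite: Lang2002, XIII §4; XVIII §5] -/
theorem sum_coeff_mul_coeff_eq_zero (hmul : ∀ π ∈ R, ∀ π' ∈ R, π * π' ∈ R) (hinv : ∀ π ∈ R, π⁻¹ ∈ R) (hne : R.Nonempty) {m m' : Fin r}
    (hlt : n m < n m') (h2t : ∀ a a' b b' : Fin (n m'), a ≠ a' → b ≠ b' → ∃ π ∈ R, π m' a = b ∧ π m' a' = b')
    (f g : Fin (n m) → ℚ) (hf : ∑ x, f x = 0) (f' g' : Fin (n m') → ℚ) (hg' : ∑ y, g' y = 0) :
    ∑ π ∈ R, (∑ x, f (π m x) * g x) * (∑ y, f' (π m' y) * g' y) = 0 := by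
  -- the averaging operator
  let T : (Fin (n m) → ℚ) →ₗ[ℚ] (Fin (n m') → ℚ) :=
    { toFun := fun x => ∑ π ∈ R, (∑ x', x (π m x') * g x') • fun y => g' ((π m')⁻¹ y)
      map_add' := fun x₁ x₂ => by
        rw [← Finset.sum_add_distrib]
        refine Finset.sum_congr rfl fun π _ => ?_
        rw [← add_smul]
        congr 1
        rw [← Finset.sum_add_distrib]
        exact Finset.sum_congr rfl fun x' _ => by rw [Pi.add_apply]; ring
      map_smul' := fun c x => by
        rw [RingHom.id_apply, Finset.smul_sum]
        refine Finset.sum_congr rfl fun π _ => ?_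
        rw [smul_smul]
        congr 1
        simp only [Pi.smul_apply, smul_eq_mul]
        rw [Finset.mul_sum]
        exact Finset.sum_congr rfl fun x' _ => by ring }
  have hT : ∀ x : Fin (n m) → ℚ, T x = ∑ π ∈ R, (∑ x', x (π m x') * g x') • fun y => g' ((π m')⁻¹ y) := fun _ => rfl
  have hTapp : ∀ (x : Fin (n m) → ℚ) (y : Fin (n m')), T x y = ∑ π ∈ R, (∑ x', x (π m x') * g x') * g' ((π m')⁻¹ y) := fun x y => by
    rw [hT, Finset.sum_apply]
    exact Finset.sum_congr rfl fun π _ => by rw [Pi.smul_apply, smul_eq_mul]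
  -- (i) the sum in question is `⟨T f, f'⟩`
  have hgoal : (∑ π ∈ R, (∑ x, f (π m x) * g x) * (∑ y, f' (π m' y) * g' y)) = ∑ y, T f y * f' y := by
    symm
    calc ∑ y, T f y * f' y = ∑ y, ∑ π ∈ R, (∑ x', f (π m x') * g x') * g' ((π m')⁻¹ y) * f' y :=
          Finset.sum_congr rfl fun y _ => by rw [hTapp f y, Finset.sum_mul]
      _ = ∑ π ∈ R, ∑ y, (∑ x', f (π m x') * g x') * g' ((π m')⁻¹ y) * f' y := Finset.sum_comm
      _ = _ := by
          refine Finset.sum_congr rfl fun π _ => ?_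
          rw [Finset.mul_sum, ← Equiv.sum_comp (π m') (fun y => (∑ x', f (π m x') * g x') * g' ((π m')⁻¹ y) * f' y)]
          refine Finset.sum_congr rfl fun t _ => ?_
          rw [Equiv.Perm.inv_def, Equiv.symm_apply_apply]
          ring
  -- (ii) `T x` is mass-zero
  have hT0 : ∀ x : Fin (n m) → ℚ, ∑ y, T x y = 0 := by
    intro x
    rw [Finset.sum_congr rfl fun y _ => hTapp x y, Finset.sum_comm]
    refine Finset.sum_eq_zero fun π _ => ?_
    rw [← Finset.mul_sum, Equiv.sum_comp (π m')⁻¹ g', hg', mul_zero]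
  -- (iii) equivariance
  have hequiv : ∀ ρ ∈ R, ∀ x : Fin (n m) → ℚ, (fun y => T x (ρ m' y)) = T (fun s => x (ρ m s)) := by
    intro ρ hρ x
    funext y
    rw [hTapp, hTapp]
    symm
    refine Finset.sum_nbij' (fun π => ρ * π) (fun π => ρ⁻¹ * π) (fun π hπ => hmul ρ hρ π hπ) (fun π hπ => hmul _ (hinv ρ hρ) π hπ)
      (fun π _ => inv_mul_cancel_left ρ π) (fun π _ => mul_inv_cancel_left ρ π) fun π _ => ?_
    have h1 : ((ρ * π) m')⁻¹ (ρ m' y) = (π m')⁻¹ y := by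
      rw [Pi.mul_apply, mul_inv_rev, Equiv.Perm.mul_apply, Equiv.Perm.inv_def (ρ m'), Equiv.symm_apply_apply]
    rw [h1]
    rfl
  -- the mass functionals and the image `W` of the mass-zero functions of slot `m`
  let L : (Fin (n m) → ℚ) →ₗ[ℚ] ℚ :=
    { toFun := fun x => ∑ i, x i
      map_add' := fun x y => by simp only [Pi.add_apply, Finset.sum_add_distrib]
      map_smul' := fun c x => by simp only [Pi.smul_apply, smul_eq_mul, RingHom.id_apply, Finset.mul_sum] }
  have hL : ∀ x, L x = ∑ i, x i := fun _ => rfl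
  let L' : (Fin (n m') → ℚ) →ₗ[ℚ] ℚ :=
    { toFun := fun x => ∑ i, x i
      map_add' := fun x y => by simp only [Pi.add_apply, Finset.sum_add_distrib]
      map_smul' := fun c x => by simp only [Pi.smul_apply, smul_eq_mul, RingHom.id_apply, Finset.mul_sum] }
  have hL' : ∀ x, L' x = ∑ i, x i := fun _ => rfl
  let W : Submodule ℚ (Fin (n m') → ℚ) := (LinearMap.ker L).map T
  have hW0 : ∀ w ∈ W, ∑ y, w y = 0 := by
    intro w hw
    obtain ⟨x, -, rfl⟩ := Submodule.mem_map.1 hw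
    exact hT0 x
  have hWH : ∀ σ ∈ R.image (fun π => π m'), ∀ w ∈ W, (fun y => w (σ y)) ∈ W := by
    intro σ hσ w hw
    obtain ⟨ρ, hρ, rfl⟩ := Finset.mem_image.1 hσ
    obtain ⟨x, hx, rfl⟩ := Submodule.mem_map.1 hw
    rw [hequiv ρ hρ x]
    refine Submodule.mem_map_of_mem ?_
    rw [LinearMap.mem_ker, hL] at hx ⊢
    rw [Equiv.sum_comp (ρ m) x]
    exact hx
  -- the image as a set of permutations: closed, non-empty, `2`-transitive
  have hmulH : ∀ σ ∈ R.image (fun π => π m'), ∀ σ' ∈ R.image (fun π => π m'), σ * σ' ∈ R.image (fun π => π m') := by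
    intro σ hσ σ' hσ'
    obtain ⟨π, hπ, rfl⟩ := Finset.mem_image.1 hσ
    obtain ⟨π', hπ', rfl⟩ := Finset.mem_image.1 hσ'
    exact Finset.mem_image.2 ⟨π * π', hmul π hπ π' hπ', rfl⟩
  have hinvH : ∀ σ ∈ R.image (fun π => π m'), σ⁻¹ ∈ R.image (fun π => π m') := by
    intro σ hσ
    obtain ⟨π, hπ, rfl⟩ := Finset.mem_image.1 hσ
    exact Finset.mem_image.2 ⟨π⁻¹, hinv π hπ, rfl⟩
  have hneH : (R.image fun π => π m').Nonempty := hne.image _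
  have h2tH : ∀ a a' b b' : Fin (n m'), a ≠ a' → b ≠ b' → ∃ σ ∈ R.image (fun π => π m'), σ a = b ∧ σ a' = b' := by
    intro a a' b b' haa hbb
    obtain ⟨π, hπ, h₁, h₂⟩ := h2t a a' b b' haa hbb
    exact ⟨π m', Finset.mem_image.2 ⟨π, hπ, rfl⟩, h₁, h₂⟩
  by_cases hWbot : W = ⊥
  · -- `T f = 0`
    have hTf : T f ∈ W := Submodule.mem_map_of_mem (by rw [LinearMap.mem_ker, hL]; exact hf)
    rw [hWbot, Submodule.mem_bot] at hTf
    rw [hgoal, hTf]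
    simp
  · -- `W` contains every mass-zero function: impossible by rank
    exfalso
    have hle : LinearMap.ker L' ≤ W := fun v hv =>
      massZero_mem_of_invariant_ne_bot hmulH hinvH hneH h2tH hW0 hWH hWbot (by rw [LinearMap.mem_ker, hL'] at hv; exact hv)
    have h1 : Module.finrank ℚ W ≤ Module.finrank ℚ (LinearMap.ker L) := Submodule.finrank_map_le _ _
    have h2 : Module.finrank ℚ (LinearMap.ker L') ≤ Module.finrank ℚ W := Submodule.finrank_mono hle
    have h3 := finrank_ker_le_of_eq_sum L hL
    have h4 := le_finrank_ker_functional L'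
    -- two letters in slot `m'` (a non-zero mass-zero function needs them)
    have h5 : 2 ≤ n m' := by
      obtain ⟨w, hwW, hw0⟩ := (Submodule.ne_bot_iff W).1 hWbot
      obtain ⟨y, hy⟩ : ∃ y, w y ≠ 0 := by
        by_contra hno
        push Not at hno
        exact hw0 (funext fun t => hno t)
      obtain ⟨y', hy'⟩ : ∃ y' : Fin (n m'), y' ≠ y := by
        by_contra hno
        push Not at hno
        have hs : ∑ t, w t = w y := Finset.sum_eq_single y (fun t _ ht => absurd (hno t) ht) (fun h => absurd (Finset.mem_univ y) h)
        exact hy (hs ▸ hW0 w hwW)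
      have := Fintype.one_lt_card_iff.2 ⟨y', y, hy'⟩
      rw [Fintype.card_fin] at this
      omega
    omega

/-- **Orthogonality, the second vector arbitrary** (centre it: `⟨f' ∘ σ, 𝟙⟩ = 0`). [cite: Serre1977, §2.2 Cor. 2–3 of Prop. 4] -/
theorem sum_coeff_mul_coeff_eq_zero' (hmul : ∀ π ∈ R, ∀ π' ∈ R, π * π' ∈ R) (hinv : ∀ π ∈ R, π⁻¹ ∈ R) (hne : R.Nonempty) {m m' : Fin r}
    (hlt : n m < n m') (h2t : ∀ a a' b b' : Fin (n m'), a ≠ a' → b ≠ b' → ∃ π ∈ R, π m' a = b ∧ π m' a' = b')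
    (f g : Fin (n m) → ℚ) (hf : ∑ x, f x = 0) (f' g' : Fin (n m') → ℚ) (hf' : ∑ y, f' y = 0) :
    ∑ π ∈ R, (∑ x, f (π m x) * g x) * (∑ y, f' (π m' y) * g' y) = 0 := by
  have hn' : (n m' : ℚ) ≠ 0 := by exact_mod_cast (show n m' ≠ 0 by omega)
  have key := sum_coeff_mul_coeff_eq_zero hmul hinv hne hlt h2t f g hf f' (fun y => g' y - (∑ t, g' t) / n m') (by
    rw [Finset.sum_sub_distrib, Finset.sum_const, Finset.card_univ, Fintype.card_fin, nsmul_eq_mul, mul_div_cancel₀ _ hn', sub_self])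
  rw [← key]
  refine Finset.sum_congr rfl fun π _ => ?_
  have h0 : ∑ y, f' (π m' y) = 0 := by rw [Equiv.sum_comp (π m') f']; exact hf'
  have h1 : ∑ y, f' (π m' y) * (g' y - (∑ t, g' t) / n m') = ∑ y, f' (π m' y) * g' y := by
    rw [Finset.sum_congr rfl fun y _ => mul_sub _ _ _, Finset.sum_sub_distrib, ← Finset.sum_mul, h0, zero_mul, sub_zero]
  rw [h1]
end Orthogonal

/-! ## §3 The centred signed slot sums are matrix coefficients -/

section Centred
variable {r : ℕ} {n : Fin r → ℕ} {R : Finset (PermsG n)} {P : ∀ m : Fin r, Finset (Fin (n m))}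

/-- `E(σ) − A = 2·⟨(𝟙_Q − |Q|/k) ∘ σ, d⟩`: the signed sum `E(σ) = Σ_a ±_{σ a ∈ Q} d(a)` minus its average `A = (2|Q| − k)(Σ d)/k` is twice the matrix coefficient
of the centred indicator of `Q` against `d` (`k ≥ 1`). [folklore] -/
theorem centred_signed_sum_eq {k : ℕ} (hk : 0 < k) (σ : Equiv.Perm (Fin k)) (Q : Finset (Fin k)) (d : Fin k → ℤ) :
    ((∑ a, (if σ a ∈ Q then d a else -d a) : ℤ) : ℚ) - (2 * (Q.card : ℚ) - k) * (∑ a, (d a : ℚ)) / k =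
      2 * ∑ a, ((if σ a ∈ Q then (1 : ℚ) else 0) - Q.card / k) * d a := by
  have hk' : (k : ℚ) ≠ 0 := by exact_mod_cast hk.ne'
  have h1 : (((∑ a, (if σ a ∈ Q then d a else -d a) : ℤ) : ℚ)) = ∑ a, (2 * (if σ a ∈ Q then (1 : ℚ) else 0) - 1) * d a := by
    push_cast
    refine Finset.sum_congr rfl fun a _ => ?_
    split_ifs <;> ring
  have hS : ∑ a, (2 * (if σ a ∈ Q then (1 : ℚ) else 0) - 1) * (d a : ℚ) = 2 * (∑ a, (if σ a ∈ Q then (1 : ℚ) else 0) * d a) - ∑ a, (d a : ℚ) := by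
    rw [Finset.mul_sum, ← Finset.sum_sub_distrib]
    exact Finset.sum_congr rfl fun a _ => by ring
  have hR : ∑ a, ((if σ a ∈ Q then (1 : ℚ) else 0) - Q.card / k) * d a =
      (∑ a, (if σ a ∈ Q then (1 : ℚ) else 0) * d a) - Q.card / k * ∑ a, (d a : ℚ) := by
    rw [Finset.mul_sum, ← Finset.sum_sub_distrib]
    exact Finset.sum_congr rfl fun a _ => by ring
  rw [h1, hS, hR]
  field_simp
  ring

/-- The centred indicator `𝟙_Q − |Q|/k` is mass-zero. [folklore] -/
theorem sum_centredIndicator_eq_zero {k : ℕ} (Q : Finset (Fin k)) : ∑ a : Fin k, ((if a ∈ Q then (1 : ℚ) else 0) - Q.card / k) = 0 := by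
  rcases Nat.eq_zero_or_pos k with hk | hk
  · subst hk
    simp
  · have hk' : (k : ℚ) ≠ 0 := by exact_mod_cast hk.ne'
    rw [Finset.sum_sub_distrib, Finset.sum_boole, Finset.sum_const, Finset.card_univ, Fintype.card_fin, nsmul_eq_mul, mul_div_cancel₀ _ hk']
    have : (Finset.univ.filter fun a : Fin k => a ∈ Q) = Q := by ext a; simp
    rw [this, sub_self]

/-- **THE CENTRED SIGNED SLOT SUMS OF A `2`-TRANSITIVE SLOT AND OF A SLOT WITH FEWER LETTERS ARE ORTHOGONAL OVER `R`.**  `R ⊆ ∏_m Sym(n_m)` non-empty, closed under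
products and inverses, `2`-transitive at `m'`, `n_m < n_{m'}`:  `Σ_{π ∈ R} (E_m(π_m) − A_m) · (E_{m'}(π_{m'}) − A_{m'}) = 0` for all position sets and all integer
functions `d_m`, `d_{m'}` — NO hypothesis relates the two slots. [cite: Serre1977, §2.2 Cor. 2–3 of Prop. 4; §2.3 Ex. 2.6] [cite: MoonenZarhin1995Duke, Thm. 2.4] -/
theorem sum_centredSigned_mul_eq_zero (hmul : ∀ π ∈ R, ∀ π' ∈ R, π * π' ∈ R) (hinv : ∀ π ∈ R, π⁻¹ ∈ R) (hne : R.Nonempty) {m m' : Fin r}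
    (hlt : n m < n m') (h2t : ∀ a a' b b' : Fin (n m'), a ≠ a' → b ≠ b' → ∃ π ∈ R, π m' a = b ∧ π m' a' = b')
    (d : Fin (n m) → ℤ) (d' : Fin (n m') → ℤ) :
    ∑ π ∈ R, ((((∑ a, (if π m a ∈ P m then d a else -d a) : ℤ) : ℚ) - (2 * ((P m).card : ℚ) - n m) * (∑ a, (d a : ℚ)) / n m) *
      (((∑ a, (if π m' a ∈ P m' then d' a else -d' a) : ℤ) : ℚ) - (2 * ((P m').card : ℚ) - n m') * (∑ a, (d' a : ℚ)) / n m')) = 0 := by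
  have hk' : 0 < n m' := by omega
  rcases Nat.eq_zero_or_pos (n m) with hk | hk
  · -- an empty slot contributes nothing
    refine Finset.sum_eq_zero fun π _ => ?_
    have he : (Finset.univ : Finset (Fin (n m))) = ∅ := Finset.univ_eq_empty_iff.2 (by rw [← Fintype.card_eq_zero_iff, Fintype.card_fin]; exact hk)
    have hP : P m = ∅ := Finset.eq_empty_of_forall_notMem fun a _ => absurd hk (Fin.pos a).ne'
    simp [he, hP, hk]
  · rw [Finset.sum_congr rfl fun π _ => by rw [centred_signed_sum_eq hk (π m) (P m) d, centred_signed_sum_eq hk' (π m') (P m') d']]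
    have key := sum_coeff_mul_coeff_eq_zero' hmul hinv hne hlt h2t (fun x => (if x ∈ P m then (1 : ℚ) else 0) - (P m).card / n m) (fun a => (d a : ℚ))
      (sum_centredIndicator_eq_zero (P m)) (fun y => (if y ∈ P m' then (1 : ℚ) else 0) - (P m').card / n m') (fun a => (d' a : ℚ))
      (sum_centredIndicator_eq_zero (P m'))
    have h4 : ∀ π : PermsG n, (2 * ∑ a, ((if π m a ∈ P m then (1 : ℚ) else 0) - (P m).card / n m) * d a) *
        (2 * ∑ a, ((if π m' a ∈ P m' then (1 : ℚ) else 0) - (P m').card / n m') * d' a) =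
        4 * ((∑ a, ((if π m a ∈ P m then (1 : ℚ) else 0) - (P m).card / n m) * d a) * ∑ a, ((if π m' a ∈ P m' then (1 : ℚ) else 0) - (P m').card / n m') * d' a) :=
      fun π => by ring
    rw [Finset.sum_congr rfl fun π _ => h4 π, ← Finset.mul_sum, key, mul_zero]
end Centred


end Summit.HodgeConjecture.CorCM.MultiFieldWeil

end
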